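import Literature.AlgebraicGeometry.Frobenioids.PadicKummerRemark221Tri
import Literature.AlgebraicGeometry.Frobenioids.PadicKummerRemark221FixedFieldKummerInj
import Literature.AlgebraicGeometry.Frobenioids.PadicKummerRemark221HilbertNinety
import Literature.NumberTheory.GaloisRepresentations.LocalUnitPowerIndexMonotone
import HarnessLib

/-!
# Frobenioids II, Remark 2.2.1 for general `N`: `H`-invariants of `O^□(A)` admit `N`-th roots

Mochizuki, *The geometry of Frobenioids II*, Kyushu J. Math. **62** (2008) 401–460, §2, Remark 2.2.1
p. 18 [cite: MochizukiFrdII2008, Rmk 2.2.1 p.18]: "the [first cohomology module portion of the]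
Galois-theoretic condition of Definition 2.2, (ii), (c), implies [upon translation into 'extension
field-theoretic language'] that any element `f ∈ O^□(A)^H` admits an `N`-th root `g ∈ O^□(A)` —
i.e., `g^N = f`."

PROOF-ONLY companion (abc-iut cell, D-0079 L-F [FrdI/II] register, row F-1198 «GAP-2R», FILE-C;
seat abc-iut-E-t32 g8; design memo abc-iut-L1-t6 g4; cut of record abc-iut-L1-lead 18:52:41Z /
19:50:48Z).  The named fact `SaturatedInvariantsAdmitRoots X N := IsNHSaturated X N →
Kummer.InvariantsAdmitRoots N X.O X.HA` (`PadicKummerSetting.lean`) was proved at the arithmetic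
context `Def22Context.ofLocalField L H hH S` (`K` of characteristic `0`, `L ⊆ K̄` finite normal,
`H ⊴ Γ_K` open, `O^□(A) = O^□_L`) under `Gal(K̄/L) ≤ H` (abc-iut-L1-t7, `PadicKummerRemark221.lean`)
and under `gcd(N, (Γ_K : H)) = 1` (abc-iut-E-t32, `PadicKummerRemark221Coprime.lean`).  This file
proves it for a non-archimedean local field `K` of characteristic `0` with NO hypothesis on `H` or
`N` — the statement of the register row verbatim (`saturatedInvariantsAdmitRoots_ofLocalField_box_general`,
`gap2r_statement`).

**The proof** (M := `K̄^H`, E := `L^{H_A} = L ∩ M`, μ := `μ_N(A) = μ_N(O^□_L)`): five inequalities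
between finite cardinals,

  `#(Eˣ/Eˣᴺ) ≤ #(Mˣ/Mˣᴺ) ≤ #H¹(H, μ) = #H¹(H_A, μ) ≤ #((Eˣ ∩ Lˣᴺ)/Eˣᴺ) ≤ #(Eˣ/Eˣᴺ)`,

all of which are therefore equalities, so `Eˣ ⊆ Lˣᴺ`: every `H_A`-invariant `f ∈ O^□_L ⊆ E`
has an `N`-th root in `L`, which lies in `O^□_L` by root-closure.  The pieces, consumed BY NAME:
* `#(Eˣ/Eˣᴺ) ≤ #(Mˣ/Mˣᴺ)` — the local unit-index formula `(Fˣ : Fˣᴺ) = N·#μ_N(F)·#(𝒪_F/N)`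
  [Neukirch, *ANT* II (5.8)] and its monotonicity along `E → M` (abc-iut-w5-d246,
  `LocalUnitIndex.natCard_quotient_range_powMonoidHom_le_of_algHom`, piece (P1)) — this is the ONLY
  place where the finiteness of the residue field enters (the statement fails for `K = ℝ((t))`,
  `L = ℝ((√t))`, `M = ℂ((t))`, `N = 2`, `f = -t`);
* `#(Mˣ/Mˣᴺ) ≤ #H¹(H, μ)` — Kummer theory for `M`, injectivity half (abc-iut-w5-d246,
  `natCard_unitsModPow_le_natCard_h1_of_algHom`, FILE-A `PadicKummerRemark221FixedFieldKummerInj.lean`);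
* `#H¹(H, μ) = #H¹(H_A, μ)` — condition (c) of Definition 2.2 (ii) (`IsCohSaturated.bijective_one_mu`),
  here abc-iut-L1-t6's `natCard_h1_HA_eq_natCard_h1_H` and `natCard_h1_HA_ofLocalField_eq_of_isNHSaturated` —
  the latter bridging the two topologies Lean puts on the finite group `H_A ≤ Gal(L/K)`: Mathlib's
  Krull topology when `H¹(H_A, μ)` is written standalone, the interface's discrete one inside `qHA`;
  they coincide, `DiscreteTopology.eq_bot`);
* `#H¹(H_A, μ) ≤ #((Eˣ ∩ Lˣᴺ)/Eˣᴺ) ≤ #(Eˣ/Eˣᴺ)` and the extraction of the root from the resulting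
  equality — Hilbert's Theorem 90 for `L/E` (FILE-B, consumer form `exists_pow_eq_of_index_le_natCard_h1`).

HONEST SCOPE. Everything here is OUR kernel check of the typed instance form of the remark at
`ofLocalField`; nothing concerns [IUTchIII]; no side taken on Cor. 3.12. Universe `0` (as the parents).

## References
* S. Mochizuki, *The geometry of Frobenioids II*, Kyushu J. Math. 62 (2008), Rmk. 2.2.1 p. 18. [MochizukiFrdII2008]
* J. Neukirch, *Algebraic Number Theory* (1999), Ch. II §5 (5.8), Ch. IV §3 (3.6). [NeukirchANT1999]
-/

noncomputable section

namespace Literature.AlgebraicGeometry.Frobenioids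

namespace PadicKummer

namespace Def22Context

open Field IntermediateField
open scoped ValuativeRel
open Literature.NumberTheory.GaloisRepresentations
open Literature.NumberTheory.GaloisRepresentations.LocalWeilDatum

section Fields

variable {K : Type} [Field K] (L : IntermediateField K (AlgebraicClosure K)) [FiniteDimensional K L] [Normal K L]
  (H : Subgroup (absoluteGaloisGroup K)) [H.Normal] (hH : IsOpen (H : Set (absoluteGaloisGroup K)))
  (S : StableSubmonoid L)

/-- Every element of `H` fixes (the image in `K̄` of) every element of `E = L^{H_A}`.
[cite: MochizukiFrdII2008, Rmk 2.2.1 p.18] -/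
theorem smul_coe_coe_eq_of_mem_invariantField (x : ↥(invariantField L H hH S))
    {σ : absoluteGaloisGroup K} (hσ : σ ∈ H) :
    σ • (((x : L) : L) : AlgebraicClosure K) = ((x : L) : AlgebraicClosure K) := by
  have hx := (mem_fixedField_iff (ofLocalField L H hH S).HA (x : L)).mp x.2 (resGal L σ)
    (Subgroup.mem_map_of_mem (resGal L) hσ)
  rw [← coe_resGal_apply, hx]

/-- `lift E ≤ K̄^H`: the image of `E = L^{H_A}` in `K̄` lies in the fixed field of `H`.
[cite: MochizukiFrdII2008, Rmk 2.2.1 p.18] -/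
theorem lift_invariantField_le_fixedField :
    lift (invariantField L H hH S) ≤
      fixedField (H.map (absoluteGaloisGroup.toAlgEquiv K).toMonoidHom) := by
  intro x hx
  obtain ⟨y, hy, rfl⟩ := hx
  rw [mem_fixedField_iff]
  intro g hg
  obtain ⟨σ, hσ, rfl⟩ := Subgroup.mem_map.mp hg
  exact smul_coe_coe_eq_of_mem_invariantField L H hH S ⟨y, hy⟩ hσ

variable (N : ℕ)

/-- (C1') `#H¹(H_A, μ_N(A)) = #H¹(H, μ_N(A))` at the arithmetic context, with `H_A ≤ Gal(L/K)` carrying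
the (discrete) Krull topology on the left — the form in which standalone statements about
`H¹(H_A, μ_N(O^□_L))` elaborate — and the interface's discrete topology inside `qHA` on the right.
[cite: MochizukiFrdII2008, Def 2.2 (ii) p.17] -/
theorem natCard_h1_HA_ofLocalField_eq_of_isNHSaturated (hsat : IsNHSaturated (ofLocalField L H hH S) N) :
    Nat.card (continuousCohomology 1 (Kummer.muTopRep N (GalMonoid S) (ofLocalField L H hH S).HA)) =
      Nat.card (continuousCohomology 1
        (TopRep.res ((ofLocalField L H hH S).qHA : (ofLocalField L H hH S).H →* (ofLocalField L H hH S).HA)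
          (Kummer.muTopRep N (GalMonoid S) (ofLocalField L H hH S).HA))) := by
  have ht : (krullTopology K ↥L : TopologicalSpace (↥L ≃ₐ[K] ↥L)) = ⊥ := DiscreteTopology.eq_bot
  convert natCard_h1_HA_eq_natCard_h1_H (ofLocalField L H hH S) N hsat using 6
  exact ht

end Fields

section LocalField

variable (K : Type) [Field K] [ValuativeRel K] [TopologicalSpace K] [IsNonarchimedeanLocalField K]
  [CharZero K] (L : IntermediateField K (AlgebraicClosure K)) [FiniteDimensional K L] [Normal K L]
  (H : Subgroup (absoluteGaloisGroup K)) [H.Normal] (hH : IsOpen (H : Set (absoluteGaloisGroup K)))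
  (S : StableSubmonoid L) (N : ℕ) [NeZero N]

/-- (C2) `#(Eˣ/Eˣᴺ) ≠ 0` for `E = L^{H_A}` (a finite extension of the local field `K`).
[cite: MochizukiFrdII2008, Rmk 2.2.1 p.18] -/
theorem index_range_powMonoidHom_invariantField_ne_zero :
    ((powMonoidHom N : (↥(invariantField L H hH S))ˣ →* (↥(invariantField L H hH S))ˣ).range).index
      ≠ 0 :=
  LocalUnitIndex.natCard_quotient_range_powMonoidHom_ne_zero_of_finiteDimensional K
    (↥(invariantField L H hH S)) (NeZero.ne N)

/-- (C3) THE CHAIN: `#(Eˣ/Eˣᴺ) ≤ #(Mˣ/Mˣᴺ) ≤ #H¹(H, μ_N(A)) = #H¹(H_A, μ_N(A))`.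
[cite: MochizukiFrdII2008, Rmk 2.2.1 p.18] -/
theorem index_range_powMonoidHom_invariantField_le_natCard_h1
    (hS1 : ∀ x : L, x ^ N = 1 → x ∈ S.toSubmonoid) (hsat : IsNHSaturated (ofLocalField L H hH S) N) :
    ((powMonoidHom N : (↥(invariantField L H hH S))ˣ →* (↥(invariantField L H hH S))ˣ).range).index ≤
      Nat.card (continuousCohomology 1 (Kummer.muTopRep N (GalMonoid S) (ofLocalField L H hH S).HA)) := by
  have hμ := coe_rootsOfUnity_mem_of_isMuSaturated L S N hsat.muSaturated
  let f : ↥(invariantField L H hH S) →ₐ[K]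
      ↥(fixedField (H.map (absoluteGaloisGroup.toAlgEquiv K).toMonoidHom)) :=
    (IntermediateField.inclusion (lift_invariantField_le_fixedField L H hH S)).comp
      (liftAlgEquiv (invariantField L H hH S)).toAlgHom
  have h1 := natCard_h1_HA_ofLocalField_eq_of_isNHSaturated L H hH S N hsat
  exact (natCard_unitsModPow_le_natCard_h1_of_algHom H N L hH S hS1 hμ f).trans (le_of_eq h1.symm)

/-- (C4) Remark 2.2.1 for any root-closed `O^□_L`, general `N`, no `Gal(K̄/L) ≤ H`.
[cite: MochizukiFrdII2008, Rmk 2.2.1 p.18] -/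
theorem saturatedInvariantsAdmitRoots_ofLocalField_of_pow_mem
    (hS : ∀ x : L, x ^ N ∈ S.toSubmonoid → x ∈ S.toSubmonoid) :
    SaturatedInvariantsAdmitRoots (ofLocalField L H hH S) N := by
  intro hsat f hf
  have hS1 : ∀ x : L, x ^ N = 1 → x ∈ S.toSubmonoid := fun x hx =>
    hS x (by rw [hx]; exact S.toSubmonoid.one_mem)
  -- `f.val ∈ E = L^{H_A}`
  let x : ↥(invariantField L H hH S) :=
    ((invariantsEquiv L H hH S ⟨f, hf⟩ : submonoidOfInvariantField L H hH S) :
      invariantField L H hH S)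
  have hxval : ((x : L) : L) = f.val := rfl
  have hx0 : x ≠ 0 := fun h => by
    have h' := congrArg (fun z : ↥(invariantField L H hH S) => ((z : L) : L)) h
    rw [hxval] at h'
    exact GalMonoid.val_ne_zero f h'
  obtain ⟨y, hy⟩ := exists_pow_eq_of_index_le_natCard_h1 L H hH S N hS1 (NeZero.ne N)
    (index_range_powMonoidHom_invariantField_ne_zero K L H hH S N)
    (index_range_powMonoidHom_invariantField_le_natCard_h1 K L H hH S N hS1 hsat) x hx0
  rw [hxval] at hy
  have hyS : y ∈ S.toSubmonoid := hS y (by rw [hy]; exact f.val_mem)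
  refine ⟨GalMonoid.mk y hyS, GalMonoid.ext ?_⟩
  rw [GalMonoid.val_pow, GalMonoid.val_mk, hy]

/-- (C5) **F-1198, general `N` — Remark 2.2.1 DISCHARGED at the arithmetic context over a
non-archimedean local field of characteristic `0`**, for `O^□_L` of Definition 2.2 (iii) (either
case of «fieldwise saturated»), WITHOUT `Gal(K̄/L) ≤ H` and WITHOUT any coprimality: the signature
of the abc-iut L-F register row F-1198 / `GAP2R_Statement` (abc-iut-E-t32 g6) verbatim.
[cite: MochizukiFrdII2008, Rmk 2.2.1 p.18] -/
theorem saturatedInvariantsAdmitRoots_ofLocalField_box_general (fs : Prop) :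
    SaturatedInvariantsAdmitRoots (ofLocalField L H hH (boxStableSubmonoid K L fs)) N :=
  saturatedInvariantsAdmitRoots_ofLocalField_of_pow_mem K L H hH (boxStableSubmonoid K L fs) N
    fun _ hx => mem_boxStableSubmonoid_of_pow_mem K L N fs (NeZero.pos N) hx

end LocalField

/-- (C6) **GAP-2R / F-1198, the register's statement as ONE proposition** — the body of
`GAP2R_Statement` (abc-iut-E-t32 g6, 2026-08-26T17:30Z) letter for letter: for every non-archimedean
local field `K` of characteristic `0`, every finite normal `L ⊆ K̄`, every open normal `H ⊴ Γ_K`,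
either choice `fs` of «fieldwise saturated» and every `N ≥ 1`, the `(N, H)`-saturated arithmetic
context `A` has `O^□(A)^H ⊆ (O^□(A))^N` ("any element `f ∈ O^□(A)^H` admits an `N`-th root
`g ∈ O^□(A)`"). [cite: MochizukiFrdII2008, Rmk 2.2.1 p.18] -/
theorem gap2r_statement :
    ∀ (K : Type) [Field K] [ValuativeRel K] [TopologicalSpace K] [IsNonarchimedeanLocalField K]
      [CharZero K] (L : IntermediateField K (AlgebraicClosure K)) [FiniteDimensional K L] [Normal K L]
      (H : Subgroup (absoluteGaloisGroup K)) [H.Normal] (hH : IsOpen (H : Set (absoluteGaloisGroup K)))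
      (fs : Prop) (N : ℕ) [NeZero N],
      SaturatedInvariantsAdmitRoots (Def22Context.ofLocalField L H hH (boxStableSubmonoid K L fs)) N :=
  fun K _ _ _ _ _ L _ _ H _ hH fs N _ =>
    saturatedInvariantsAdmitRoots_ofLocalField_box_general K L H hH N fs

end Def22Context

end PadicKummer

end Literature.AlgebraicGeometry.Frobenioids

end
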